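import Summits.ValiantsHypothesis.ValiantsHypothesis.Theses.AlgebraicKWGames

/-!
# ValiantsHypothesis / AlgebraicKWGames — item `Assembly` (stmt-ValiantsHypothesis-10303)

`VPLogSquaredDepth → KWPerLowerBound → FormulaToProtocol → ValiantsHypothesis`: if `VP ℂ = VNP ℂ`
then `per ∈ VP` (`perFamily_mem_VNP_holds`, `mem_VP_ofFintype_iff_holds`), so by `VPLogSquaredDepth`
the permanent has fan-in-two circuits of depth `c₁ (log₂ n + 1)²`, which `FormulaToProtocol` turns
into KW-protocols of depth `2 c₁ (log₂ n + 1)²` for every `n ≥ 2` — contradicting `KWPerLowerBound`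
at `c = 2 c₁`. The same ten lines as the route's deciding theorem `closes`. HONEST FRAMING:
bookkeeping over OPEN cruxes; nothing here is progress on `VP ≠ VNP`.
-/

-- layout Summits/ValiantsHypothesis/ValiantsHypothesis forces the duplicated namespace component
set_option linter.dupNamespace false

namespace Summit.ValiantsHypothesis.ValiantsHypothesis.Theorems.AlgebraicKWGames

open Literature.Computability.AlgebraicComplexity

/-- **Item `Assembly` (stmt-ValiantsHypothesis-10303):**
`VPLogSquaredDepth → KWPerLowerBound → FormulaToProtocol → ValiantsHypothesis`. [folklore] -/
theorem assembly_proof : Theses.AlgebraicKWGames.Assembly := by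
  unfold Theses.AlgebraicKWGames.Assembly
  intro h_VPLogSquaredDepth h_KWPerLowerBound h_FormulaToProtocol
  show VP ℂ ≠ VNP ℂ
  intro hEq
  have hVNP := perFamily_mem_VNP_holds ℂ
  have hVP : perFamily ℂ ∈ VP ℂ := by rw [hEq]; exact hVNP
  have hfam : IsVPFamily (fun n => perPoly (Fin n) ℂ) := (mem_VP_ofFintype_iff_holds _).1 hVP
  obtain ⟨c₁, hc₁⟩ := h_VPLogSquaredDepth (fun n => perPoly (Fin n) ℂ) hfam
  obtain ⟨n, hn2, hn⟩ := h_KWPerLowerBound (2 * c₁)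
  apply hn
  obtain ⟨P, hP2, hPc, hPd⟩ := hc₁ n
  haveI : NeZero n := ⟨by omega⟩
  exact h_FormulaToProtocol (Fin n × Fin n) _ (c₁ * (Nat.log 2 n + 1) ^ 2) (2 * c₁ * (Nat.log 2 n + 1) ^ 2)
    (Nat.mul_assoc _ _ _).ge ⟨P, hP2, hPc, hPd⟩

end Summit.ValiantsHypothesis.ValiantsHypothesis.Theorems.AlgebraicKWGames
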